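import Mathlib.MeasureTheory.Integral.IntegralEqImproper
import Literature.Analysis.SpecialFunctions.InvSinSqPartialFractions
import HarnessLib

/-!
# `RigorousRGSmallParameter` (Slade, Theorem 1.4.1): the integral decomposition of `1/ζ` behind
# the finite-range decomposition of the lattice Green function (BBS, Ch. 3, "Integral decomposition")

The finite-range decomposition `(-Δ_{ℤ^d}+s)⁻¹ = Σ_j Γ_j(s)` of [Baue13a], imported by Slade §3.1
and analysed in §10.1 through the function `w(t,x;s)`, starts from an integral decomposition of
the Fourier multiplier `1/(λ(k)+s)`. Following R. Bauerschmidt, D. Brydges, G. Slade,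
*Introduction to a renormalisation group method* (LNM 2242, 2019; arXiv:1907.05474), Ch. 3,
section "Finite-range decomposition: lattice", subsection "Integral decomposition": for a profile
`f : ℝ → [0,∞)` one sets (first display of the subsection)
`f*_t(x) = Σ_{n∈ℤ} f(xt - 2πnt)` (`x ∈ ℝ`, `t > 0`) and, for `ζ ∈ [0,4]`,
`P_t(ζ) = f*_t(arccos(1 - ½ζ))`; the two lemmas of the subsection are
"For `x ∈ ℝ ∖ 2πℤ`, `¼ sin⁻²(½x) = ∫₀^∞ t² f*_t(x) dt/t`" and
"For `ζ ∈ (0,4)`, `1/ζ = ∫₀^∞ t² P_t(ζ) dt/t`", under the normalisation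
`1/|k|² = ∫₀^∞ t² f(|k|t) dt/t` of `f` (i.e. `∫₀^∞ u f(u) du = 1`); the printed proof of the first is
"Its development into partial fractions is `¼ sin⁻²(½x) = Σ_{n∈ℤ}(x-2πn)⁻²` … it follows that
`¼ sin⁻²(½x) = Σ_{n∈ℤ} ∫₀^∞ t² f((x-2πn)t) dt/t`. By hypothesis, `f` is symmetric … The order of
the sum and the integral can be exchanged, by non-negativity of the integrand", and of the second
"Let `x = arccos(1 - ½ζ)`, so that `ζ = 2(1 - cos x) = 4 sin²(½x)`".

## What this file provides

* `FRD.periodicProfile f t x` — `f*_t(x) = Σ_{n∈ℤ} f(xt - 2πnt)`; `FRD.chebyProfile f t ζ` —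
  `P_t(ζ) = f*_t(arccos(1 - ζ/2))` (definitions with bodies).
* `FRD.integral_mul_comp_mul_Ioi` — the change of variables `∫₀^∞ t f(at) dt = a⁻² ∫₀^∞ u f(u) du`
  for an even profile and `a ≠ 0`.
* **`FRD.integral_mul_periodicProfile`** — the first lemma, with the normalisation constant kept
  explicit: for `f ≥ 0` measurable and even with `u ↦ u f(u)` integrable on `(0,∞)`, and
  `x ∉ 2πℤ`, `∫₀^∞ t f*_t(x) dt = (∫₀^∞ u f(u) du) · ¼ sin⁻²(½x)` (all integrals Lebesgue on
  `(0,∞)`; `t² dt/t = t dt`); the interchange of sum and integral is `integral_tsum`, the partial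
  fractions are `Literature.Analysis.SpecialFunctions.hasSum_int_inv_sub_two_pi_mul_sq`.
* **`FRD.integral_mul_chebyProfile`** — the second lemma: for `ζ ∈ (0,4)`,
  `∫₀^∞ t P_t(ζ) dt = (∫₀^∞ u f(u) du)/ζ`.

No named fact is introduced. Not treated here: the polynomiality of `P_t` (Poisson summation and
Chebyshev polynomials), the existence of an admissible `f` with `f̂ ∈ C_c^∞[-1,1]`, and the
estimates on `P_t` and `w`.
-/

noncomputable section

namespace Literature.Barriers.CriticalPhenomena

open _root_.MeasureTheory Set Filter
open scoped _root_.Topology Real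

namespace LongRangePhi4

namespace FRD

/-- **The periodised profile** `f*_t(x) = Σ_{n∈ℤ} f(xt - 2πnt)` (BBS, "Integral decomposition",
first display). [cite: BauerschmidtBrydgesSlade2019RG, Ch. 3, "Finite-range decomposition: lattice" (definition of f*_t)] -/
def periodicProfile (f : ℝ → ℝ) (t x : ℝ) : ℝ := ∑' n : ℤ, f (x * t - 2 * π * n * t)

/-- **The profile in the spectral variable** `P_t(ζ) = f*_t(arccos(1 - ½ζ))`, `ζ ∈ [0,4]` (BBS,
"Integral decomposition", the display defining `P_t`). [cite: BauerschmidtBrydgesSlade2019RG, Ch. 3, "Finite-range decomposition: lattice" (definition of P_t)] -/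
def chebyProfile (f : ℝ → ℝ) (t ζ : ℝ) : ℝ := periodicProfile f t (Real.arccos (1 - ζ / 2))

/-- `f*_t(x)` unfolds to its defining series. [folklore] -/
theorem periodicProfile_eq (f : ℝ → ℝ) (t x : ℝ) :
    periodicProfile f t x = ∑' n : ℤ, f ((x - 2 * π * n) * t) := by
  unfold periodicProfile
  exact tsum_congr fun n => by ring_nf

/-! ### The change of variables `∫₀^∞ t f(at) dt = a⁻² ∫₀^∞ u f(u) du` -/

/-- For `b > 0`: `∫₀^∞ t f(bt) dt = b⁻² ∫₀^∞ u f(u) du`. [folklore] -/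
theorem integral_mul_comp_mul_Ioi_of_pos (f : ℝ → ℝ) {b : ℝ} (hb : 0 < b) :
    ∫ t in Ioi (0 : ℝ), t * f (b * t) = (1 / b ^ 2) * ∫ u in Ioi (0 : ℝ), u * f u := by
  have h := integral_comp_mul_left_Ioi (fun u => u / b * f u) 0 hb
  simp only [mul_zero, smul_eq_mul] at h
  have h1 : (∫ t in Ioi (0 : ℝ), b * t / b * f (b * t)) = ∫ t in Ioi (0 : ℝ), t * f (b * t) := by
    refine setIntegral_congr_fun measurableSet_Ioi fun t _ => ?_
    rw [mul_div_cancel_left₀ _ hb.ne']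
  rw [← h1, h]
  have h2 : (∫ u in Ioi (0 : ℝ), u / b * f u) = b⁻¹ * ∫ u in Ioi (0 : ℝ), u * f u := by
    rw [← integral_const_mul]
    refine setIntegral_congr_fun measurableSet_Ioi fun u _ => ?_
    ring
  rw [h2]
  field_simp

/-- **Change of variables for an even profile**: for `a ≠ 0` and `f` even,
`∫₀^∞ t f(at) dt = a⁻² ∫₀^∞ u f(u) du` ("By hypothesis, `f` is symmetric, so [the identity] holds
when `|k|` in the right-hand side is replaced by the possibly negative `x - 2πn`").
[cite: BauerschmidtBrydgesSlade2019RG, Ch. 3, "Finite-range decomposition: lattice" (proof of the first lemma)] -/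
theorem integral_mul_comp_mul_Ioi (f : ℝ → ℝ) (heven : ∀ u, f (-u) = f u) {a : ℝ} (ha : a ≠ 0) :
    ∫ t in Ioi (0 : ℝ), t * f (a * t) = (1 / a ^ 2) * ∫ u in Ioi (0 : ℝ), u * f u := by
  rcases lt_or_gt_of_ne ha with h | h
  · have h' : 0 < -a := by linarith
    have e : (fun t : ℝ => t * f (a * t)) = fun t => t * f (-a * t) := by
      funext t
      rw [neg_mul, heven]
    rw [show (∫ t in Ioi (0 : ℝ), t * f (a * t)) = ∫ t in Ioi (0 : ℝ), t * f (-a * t) from by rw [e],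
      integral_mul_comp_mul_Ioi_of_pos f h', neg_sq]
  · exact integral_mul_comp_mul_Ioi_of_pos f h

/-- Integrability transfers under the change of variables: if `u ↦ u f(u)` is integrable on `(0,∞)`
and `f` is even, so is `t ↦ t f(at)` for `a ≠ 0`. [folklore] -/
theorem integrableOn_mul_comp_mul_Ioi (f : ℝ → ℝ) (heven : ∀ u, f (-u) = f u)
    (hint : IntegrableOn (fun u => u * f u) (Ioi 0)) {a : ℝ} (ha : a ≠ 0) :
    IntegrableOn (fun t => t * f (a * t)) (Ioi 0) := by
  -- reduce to `a > 0` by evenness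
  wlog h : 0 < a generalizing a
  · have h' : 0 < -a := by
      rcases lt_or_gt_of_ne ha with h1 | h1
      · linarith
      · exact absurd h1 h
    have e : (fun t : ℝ => t * f (a * t)) = fun t => t * f (-a * t) := by
      funext t
      rw [neg_mul, heven]
    rw [e]
    exact this (neg_ne_zero.2 ha) h'
  have hint' : IntegrableOn (fun u : ℝ => u / a * f u) (Ioi 0) := by
    have h0 : IntegrableOn (fun u : ℝ => 1 / a * (u * f u)) (Ioi 0) := hint.const_mul (1 / a)
    exact h0.congr_fun (fun u _ => by ring) measurableSet_Ioi
  have h1 : IntegrableOn (fun t : ℝ => (a * t) / a * f (a * t)) (Ioi 0) := by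
    have := (integrableOn_Ioi_comp_mul_left_iff (fun u => u / a * f u) 0 h).2
      (by rw [mul_zero]; exact hint')
    exact this
  refine h1.congr_fun (fun t _ => ?_) measurableSet_Ioi
  show a * t / a * f (a * t) = t * f (a * t)
  rw [mul_div_cancel_left₀ _ h.ne']

/-! ### The first lemma: `¼ sin⁻²(½x) ∫₀^∞ u f = ∫₀^∞ t f*_t(x) dt` -/

/-- **BBS, the first lemma of "Integral decomposition", PROVED (normalisation explicit).** Let
`f : ℝ → ℝ` be measurable, nonnegative and even, with `u ↦ u f(u)` integrable on `(0,∞)`, and let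
`x ∈ ℝ ∖ 2πℤ`. Then `∫₀^∞ t f*_t(x) dt = (∫₀^∞ u f(u) du) · ¼ sin⁻²(½x)`; with the book's
normalisation `∫₀^∞ u f(u) du = 1` (its (eq:1/lambda-decomp)) this is
"`¼ sin⁻²(½x) = ∫₀^∞ t² f*_t(x) dt/t`". Printed proof, followed: partial fractions
`¼ sin⁻²(½x) = Σ_n (x-2πn)⁻²`, the change of variables in each term (evenness of `f` for the
negative `x - 2πn`), and the exchange of sum and integral by non-negativity.
[cite: BauerschmidtBrydgesSlade2019RG, Ch. 3, "Finite-range decomposition: lattice" (first lemma of "Integral decomposition")] -/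
theorem integral_mul_periodicProfile {f : ℝ → ℝ} (hf : Measurable f) (hf0 : ∀ u, 0 ≤ f u)
    (heven : ∀ u, f (-u) = f u) (hint : IntegrableOn (fun u => u * f u) (Ioi 0))
    {x : ℝ} (hx : ∀ n : ℤ, x ≠ 2 * π * n) :
    ∫ t in Ioi (0 : ℝ), t * periodicProfile f t x =
      (∫ u in Ioi (0 : ℝ), u * f u) * (1 / (4 * Real.sin (x / 2) ^ 2)) := by
  set c : ℝ := ∫ u in Ioi (0 : ℝ), u * f u with hc
  have hc0 : 0 ≤ c := setIntegral_nonneg measurableSet_Ioi fun u hu => mul_nonneg hu.le (hf0 u)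
  have ha : ∀ n : ℤ, x - 2 * π * n ≠ 0 := fun n => sub_ne_zero.2 (hx n)
  -- the terms
  set F : ℤ → ℝ → ℝ := fun n t => t * f ((x - 2 * π * n) * t) with hF
  have hFint : ∀ n, IntegrableOn (F n) (Ioi 0) := fun n =>
    integrableOn_mul_comp_mul_Ioi f heven hint (ha n)
  have hFval : ∀ n, ∫ t in Ioi (0 : ℝ), F n t = c * (1 / (x - 2 * π * n) ^ 2) := by
    intro n
    simp only [hF]
    rw [integral_mul_comp_mul_Ioi f heven (ha n), hc, mul_comm]
  have hFnn : ∀ n, ∀ t ∈ Ioi (0 : ℝ), 0 ≤ F n t := fun n t ht => mul_nonneg ht.le (hf0 _)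
  have hFmeas : ∀ n, AEStronglyMeasurable (F n) ((volume : Measure ℝ).restrict (Ioi 0)) := by
    intro n
    exact (measurable_id.mul (hf.comp (measurable_const.mul measurable_id))).aestronglyMeasurable
  -- the partial fractions
  have hpf := Literature.Analysis.SpecialFunctions.hasSum_int_inv_sub_two_pi_mul_sq hx
  -- finiteness of the sum of the integrals
  have hfin : ∑' n : ℤ, ∫⁻ t in Ioi (0 : ℝ), ‖F n t‖ₑ ≠ ⊤ := by
    have he : ∀ n : ℤ, ∫⁻ t in Ioi (0 : ℝ), ‖F n t‖ₑ =
        ENNReal.ofReal (c * (1 / (x - 2 * π * n) ^ 2)) := by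
      intro n
      rw [← hFval n, ofReal_integral_eq_lintegral_ofReal (hFint n)
        ((ae_restrict_mem measurableSet_Ioi).mono fun t ht => hFnn n t ht)]
      exact setLIntegral_congr_fun measurableSet_Ioi fun t ht => Real.enorm_eq_ofReal (hFnn n t ht)
    simp_rw [he]
    rw [← ENNReal.ofReal_tsum_of_nonneg (fun n => by positivity) (hpf.mul_left c).summable]
    exact ENNReal.ofReal_ne_top
  have hswap := integral_tsum hFmeas hfin
  -- assemble
  have hL : (fun t => t * periodicProfile f t x) = fun t => ∑' n : ℤ, F n t := by
    funext t
    rw [periodicProfile_eq, ← tsum_mul_left]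
  rw [hL, hswap]
  simp_rw [hFval]
  rw [tsum_mul_left, hpf.tsum_eq]

/-! ### The second lemma: `1/ζ ∫₀^∞ u f = ∫₀^∞ t P_t(ζ) dt` -/

/-- `4 sin²(½ arccos(1 - ½ζ)) = ζ` for `ζ ∈ [0,4]` ("`ζ = 2(1 - cos x) = 4 sin²(½x)`").
[cite: BauerschmidtBrydgesSlade2019RG, Ch. 3, "Finite-range decomposition: lattice" (proof of the second lemma)] -/
theorem four_mul_sin_sq_half_arccos {ζ : ℝ} (h0 : 0 ≤ ζ) (h4 : ζ ≤ 4) :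
    4 * Real.sin (Real.arccos (1 - ζ / 2) / 2) ^ 2 = ζ := by
  have hcos : Real.cos (Real.arccos (1 - ζ / 2)) = 1 - ζ / 2 :=
    Real.cos_arccos (by linarith) (by linarith)
  have h := Real.sin_sq_eq_half_sub (Real.arccos (1 - ζ / 2) / 2)
  rw [show 2 * (Real.arccos (1 - ζ / 2) / 2) = Real.arccos (1 - ζ / 2) by ring, hcos] at h
  rw [h]
  ring

/-- **BBS, the second lemma of "Integral decomposition", PROVED (normalisation explicit).** For
`f` as in `integral_mul_periodicProfile` and `ζ ∈ (0,4)`: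
`∫₀^∞ t P_t(ζ) dt = (∫₀^∞ u f(u) du)/ζ` — i.e. "`1/ζ = ∫₀^∞ t² P_t(ζ) dt/t`" under the
normalisation `∫₀^∞ u f = 1`. Proof as printed: `x = arccos(1 - ½ζ) ∈ (0,π)` is not in `2πℤ` and
`4 sin²(½x) = ζ`. [cite: BauerschmidtBrydgesSlade2019RG, Ch. 3, "Finite-range decomposition: lattice" (second lemma of "Integral decomposition")] -/
theorem integral_mul_chebyProfile {f : ℝ → ℝ} (hf : Measurable f) (hf0 : ∀ u, 0 ≤ f u)
    (heven : ∀ u, f (-u) = f u) (hint : IntegrableOn (fun u => u * f u) (Ioi 0))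
    {ζ : ℝ} (h0 : 0 < ζ) (h4 : ζ < 4) :
    ∫ t in Ioi (0 : ℝ), t * chebyProfile f t ζ = (∫ u in Ioi (0 : ℝ), u * f u) / ζ := by
  set x : ℝ := Real.arccos (1 - ζ / 2) with hxdef
  have hxpos : 0 < x := Real.arccos_pos.2 (by linarith)
  have hxpi : x ≤ π := Real.arccos_le_pi _
  have hx : ∀ n : ℤ, x ≠ 2 * π * n := by
    intro n h
    rcases lt_trichotomy n 0 with hn | hn | hn
    · have hn' : (n : ℝ) ≤ -1 := by exact_mod_cast Int.le_sub_one_iff.2 hn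
      have : x ≤ -(2 * π) := by rw [h]; nlinarith [Real.pi_pos]
      linarith [Real.pi_pos]
    · subst hn
      simp at h
      linarith
    · have hn' : (1 : ℝ) ≤ n := by exact_mod_cast hn
      have : 2 * π ≤ x := by rw [h]; nlinarith [Real.pi_pos]
      linarith [Real.pi_pos]
  have h := integral_mul_periodicProfile hf hf0 heven hint hx
  have hζ : 4 * Real.sin (x / 2) ^ 2 = ζ := four_mul_sin_sq_half_arccos h0.le h4.le
  unfold chebyProfile
  rw [← hxdef, h, hζ]
  ring

end FRD

end LongRangePhi4

end Literature.Barriers.CriticalPhenomena
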